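import Summits.BirchSwinnertonDyer.BirchSwinnertonDyer.Theorems.KolyvaginRankRigidityAtTwoChebotarevTwoLevel
import HarnessLib

/-!
# Crux V2♭ `KolyvaginCorankLowerBoundAtTwo` (stmt-BirchSwinnertonDyer-24623), line `kolyvagin_depth_split`,
# stub T5⁺, input T5b(a′) WITH THE MARGIN, part 2: one-class Čebotarev at `2` ONE LEVEL UP
# (helper, PROVED, unconditional; width seat `bsd-line-krr2-p2` g6)

The window step T5b of the lead's skeleton works with the class `c_M(n)` (level `2^M`) but needs the
NEW Kolyvagin prime `q` to have index `M(q) ≥ M + 1` (the margin of T1: `2^{M+1} ∣ q + 1`,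
`2^{M+1} ∣ a_q`), i.e. Čebotarev is run in `K(E[2^{M+1}])` while the local criterion is read for a
class with `E[2^M]` coefficients. With part 1 (`…ChebotarevTwoLevel`: Sah at `2` on
`Γ_{K(E[2^{M'}])}`, two-level Steps C–G) and the algebra file (Weil-pairing bit, dévissage):

* `exists_kolyvaginPrime_gt_two_eigenclass_of_le` — **for `κ ∈ H¹(K, E[2^M])` with `c_*κ = εκ`
  (`ε = ±1`), `2^{m-1}κ ≠ 0`, and any `M' ≥ M`: above every bound a Kolyvagin prime `ℓ` at `2` with
  `M' ≤ M(ℓ)` (`Frob ℓ = Frob ∞` on `K(E[2^{M'}])`) and `2^j κ` NOT locally trivial at `λ ∣ ℓ` for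
  `j + 3 ≤ m`** — both signs of `Δ_E`, both eigen-signs, no restriction-injectivity binder, loss two
  bits, UNCONDITIONAL (Čebotarev = the tree's proved `Automorphic.chebotarev_artinRep_of_galoisSide`);
* `setInfinite_kolyvaginPrime_two_eigenclass_of_le` — the `Set.Infinite` form;
* `exists_kolyvaginPrime_notMem_two_eigenclass` — **the T5b(a′)-shaped form**: in the binders of the
  lead's window step (`2^{e'} κ ≠ 0` for `e' + e < M`; a finite set `S` to avoid): `∃ q ∉ S`,
  Kolyvagin at `2`, `M + 1 ≤ M(q)`, `∃ v ∋ q`, `2^{e'} κ ∉ ker loc_v` for `e' + e + 2 < M` (`D = 2`).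

HONEST FRAMING: helper (`--supports` 24623). This is input (a′) of the window step ONLY: the class fed
in T5b is `c_M(∏ S)` (an `ε`-eigenclass by the landed T3 `stub_conjSign`; `d_K·Δ_E ∉ ℚ^{×2}` holds
on the habitat since `K = ℚ(√Δ_E)` would ramify at the primes of `N`, against (Heeg)); the duality
half (b′) — a datum on the new window with a class of large order — and strong non-vanishing T5a are
untouched; T5⁺ and V2♭ are NOT proved; BSD is not proved by any of this.

References: [McCallumLMS1991] §3 Prop. 3.1, Cor. 3.2; [GrossLMS1991] §9; [Kolyvagin1991MathAnn] §2
(proof of Thm. 2.2; ref. [1] Prop. 8); [WZhang2014] Notations (xii); [TateGCFT1967] §2.4.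
-/

set_option autoImplicit false
-- the Theorems namespace of this sub repeats the summit name by design (D-0017 nested layout)
set_option linter.dupNamespace false

noncomputable section

open scoped Classical Pointwise

namespace Summit.BirchSwinnertonDyer.BirchSwinnertonDyer.Theorems.KolyvaginLowerBoundAtTwo

open WeierstrassCurve Field NumberField IsDedekindDomain
open Literature.NumberTheory.GaloisRepresentations Literature.NumberTheory.EllipticCurves
open Literature.NumberTheory Rat.HeightOneSpectrum

universe u

section Shifted

variable {W : WeierstrassCurve ℚ}

/-! ### Step B′: the Galois element for one eigenclass -/

set_option maxHeartbeats 800000 in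
/-- **Step B′ at `2` (one eigenclass, both signs of `Δ_E`).** For `κ ∈ H¹(K, E[2^M])` with
`c_* κ = ε κ` and `2^{m-1} κ ≠ 0`, and `M ≤ M'`, there is `ρ ∈ Γ_{K(E[2^{M'}])}` such that
`ε τ[κ, ρ] + [κ, ρ]` — the value `[κ, (ρ')^τ ρ']` at the Frobenius of a Kolyvagin prime with
`Frob = τρ'`, `ρ' ∈ ρ𝒩` — has order `≥ 2^{m-2}`. Ingredients: `-1 ∈ ρ̄(Γ_K)` and Sah at `2` on
`Γ_{K(E[2^{M'}])}` (one bit), dévissage (the image of `[κ, ·]` contains `E[2^M][2^{m-1}]`), and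
the Weil-pairing bit `(1 + ε c₀) E[2^{m-1}] ⊄ E[2^{m-1}][2^{m-3}]` (one bit).
[cite: McCallumLMS1991, §3 (2), Prop. 3.1] [cite: GrossLMS1991, §9 Prop. 9.1, 9.3] -/
theorem exists_mem_torsionFixing_eigenvalue_large [W.IsElliptic] {K : Type} [Field K]
    [NumberField K] (hK : IsImaginaryQuadratic K)
    (hns : ¬ IsSquare ((NumberField.discr K : ℚ) * W.Δ))
    (hρ : ∀ n : ℕ, W.HasSurjectiveModNGaloisRep (2 ^ n : ℕ)) {c : K ≃ₐ[ℚ] K}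
    {c₀ : absoluteGaloisGroup ℚ} (hc₀ : IsComplexConjugation (Rat.castHom ℝ) c₀)
    (ht : IsLiftOfAut c (absGaloisTransport (K := ℚ) (L := K) c₀).toRingEquiv)
    {M M' : ℕ} (hM : 1 ≤ M) (hMM' : M ≤ M') (κ : galH1Torsion (W.baseChange K) ((2 ^ M : ℕ) : ℤ))
    {ε : ℤ} (hε : ε = 1 ∨ ε = -1) {m : ℕ} (hm : (2 : ℤ) ^ (m - 1) • κ ≠ 0) :
    ∃ ρ ∈ torsionFixing (W.baseChange K) ((2 ^ M' : ℕ) : ℤ), ∀ j : ℕ, j + 3 ≤ m →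
      (2 : ℤ) ^ j • (ε • ht.torsionMap W ((2 ^ M : ℕ) : ℤ)
        (h1Eval (W.baseChange K) ((2 ^ M : ℕ) : ℤ) κ ρ) +
        h1Eval (W.baseChange K) ((2 ^ M : ℕ) : ℤ) κ ρ) ≠ 0 := by
  classical
  haveI : Fact (Nat.Prime 2) := ⟨Nat.prime_two⟩
  have hM' : 1 ≤ M' := hM.trans hMM'
  have hdvdMM' : ((2 ^ M : ℕ) : ℤ) ∣ ((2 ^ M' : ℕ) : ℤ) := by exact_mod_cast Nat.pow_dvd_pow 2 hMM'
  have hle := torsionFixing_le_of_dvd (W.baseChange K) hdvdMM'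
  by_cases hm3 : m < 3
  · exact ⟨1, Subgroup.one_mem _, fun j hj ↦ absurd hj (by omega)⟩
  push Not at hm3
  -- (a) an element acting as `-1` on `E[2^{M'}]`, and Sah on `Γ_{K(E[2^{M'}])}`
  obtain ⟨z, hz⟩ := exists_smul_eq_neg_two_pow W hK.1 hM' (hρ M')
  obtain ⟨g₀, hg₀, hg₀ne⟩ : ∃ g₀ ∈ torsionFixing (W.baseChange K) ((2 ^ M' : ℕ) : ℤ),
      (2 : ℤ) ^ (m - 2) • h1Eval (W.baseChange K) ((2 ^ M : ℕ) : ℤ) κ g₀ ≠ 0 := by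
    by_contra! hall
    apply hm
    have h2 : (2 : ℤ) • ((2 : ℤ) ^ (m - 2) • κ) = 0 :=
      two_zsmul_eq_zero_of_h1Eval_eq_zero_of_dvd (W.baseChange K) hdvdMM' hz fun g hg ↦ by
        rw [h1Eval_zsmul _ _ _ _ (hle hg)]; exact hall g hg
    rw [smul_smul, ← pow_succ'] at h2
    have e : m - 2 + 1 = m - 1 := by omega
    rwa [e] at h2
  -- (b) the image of `[κ, ·]` on `Γ_{K(E[2^{M'}])}`: stable, hence `⊇ E[2^M][2^{m-1}]`
  set H : AddSubgroup (geomTorsion (W.baseChange K) ((2 ^ M : ℕ) : ℤ)) :=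
    { carrier := {t | ∃ g ∈ torsionFixing (W.baseChange K) ((2 ^ M' : ℕ) : ℤ),
        h1Eval (W.baseChange K) ((2 ^ M : ℕ) : ℤ) κ g = t}
      add_mem' := by
        rintro _ _ ⟨g₁, hg₁, rfl⟩ ⟨g₂, hg₂, rfl⟩
        exact ⟨g₁ * g₂, mul_mem hg₁ hg₂, h1Eval_mul _ _ κ (hle hg₁) g₂⟩
      zero_mem' := ⟨1, Subgroup.one_mem _, h1Eval_one _ _ κ⟩
      neg_mem' := by
        rintro _ ⟨g, hg, rfl⟩
        exact ⟨g⁻¹, inv_mem hg, h1Eval_inv _ _ κ (hle hg)⟩ } with hH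
  have hHstab : ∀ g : absoluteGaloisGroup K, ∀ t ∈ H, g • t ∈ H := by
    rintro g t ⟨g₁, hg₁, rfl⟩
    exact ⟨g * g₁ * g⁻¹, (torsionFixing_normal _ _).conj_mem _ hg₁ g,
      h1Eval_conj _ _ κ g (hle hg₁)⟩
  have hsurj2 : W.HasSurjectiveModNGaloisRep 2 := by simpa using hρ 1
  have hS := (GenusExact.image_two_of_not_isSquare W K hK.1 hsurj2 hns).1
  have hHbig : ∀ t : geomTorsion (W.baseChange K) ((2 ^ M : ℕ) : ℤ),
      (2 : ℤ) ^ (m - 1) • t = 0 → t ∈ H := by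
    intro t ht
    have e : m - 2 + 1 = m - 1 := by omega
    exact torsionBy_le_of_stable_of_pow_smul_ne_zero (W.baseChange K) M hS (m - 2) H hHstab
      ⟨_, ⟨g₀, hg₀, rfl⟩, hg₀ne⟩ t (by rw [e]; exact ht)
  -- (c) the Weil-pairing bit over `ℚ`: `x ∈ E[2^M]`, `2^{m-1} x = 0`, `2^{m-3}(x + ε c₀ x) ≠ 0`
  have hmM : m - 1 ≤ M := by
    by_contra hlt
    apply hm
    have hkill : ((2 : ℤ) ^ M) • κ = 0 := by
      have := zsmul_galH1Torsion_eq_zero _ _ κ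
      exact_mod_cast this
    have : (2 : ℤ) ^ (m - 1) • κ = (2 : ℤ) ^ (m - 1 - M) • ((2 : ℤ) ^ M • κ) := by
      rw [smul_smul, ← pow_add, Nat.sub_add_cancel (by omega)]
    rw [this, hkill, zsmul_zero]
  obtain ⟨x₀, hx₀⟩ := exists_pow_smul_add_sign_conj_ne_zero W hc₀ (m := m - 1) (by omega) hε
  have hdvd : ((2 ^ (m - 1) : ℕ) : ℤ) ∣ ((2 ^ M : ℕ) : ℤ) := by
    exact_mod_cast Nat.pow_dvd_pow 2 hmM
  set incl : geomTorsion W ((2 ^ (m - 1) : ℕ) : ℤ) →+ geomTorsion W ((2 ^ M : ℕ) : ℤ) :=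
    AddSubgroup.inclusion (W.geomTorsion_le_of_dvd hdvd) with hincl
  have hincl_inj : Function.Injective incl := AddSubgroup.inclusion_injective _
  have hincl_smul : ∀ y, incl (c₀ • y) = c₀ • incl y := fun _ ↦ rfl
  set x := incl x₀ with hx
  have hxkill : (2 : ℤ) ^ (m - 1) • x = 0 := by
    apply Subtype.ext
    rw [AddSubgroupClass.coe_zsmul, ZeroMemClass.coe_zero]
    change (2 : ℤ) ^ (m - 1) • (x₀ : geomPoints W) = 0
    have := (mem_geomTorsion_iff W _ (x₀ : geomPoints W)).mp x₀.2
    exact_mod_cast this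
  have hxne : (2 : ℤ) ^ (m - 3) • (x + ε • c₀ • x) ≠ 0 := by
    intro h0
    apply hx₀
    apply hincl_inj
    rw [map_nsmul, map_add, map_zsmul, hincl_smul, map_zero, ← hx,
      show m - 1 - 2 = m - 3 by omega, ← natCast_zsmul]
    exact_mod_cast h0
  -- (d) transport to `E(K̄)[2^M]`
  set θ := RatClosure.torsionEquiv (K := K) W ((2 ^ M : ℕ) : ℤ) with hθ
  have hθc : ∀ P, θ (c₀ • P) = ht.torsionMap W ((2 ^ M : ℕ) : ℤ) (θ P) := fun P ↦
    RatClosure.torsionEquiv_smul_of_lift W ht c₀ (fun _ ↦ rfl) _ P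
  have hx'kill : (2 : ℤ) ^ (m - 1) • θ x = 0 := by rw [← map_zsmul, hxkill, map_zero]
  have hx'ne : ∀ j : ℕ, j + 3 ≤ m →
      (2 : ℤ) ^ j • (ε • ht.torsionMap W ((2 ^ M : ℕ) : ℤ) (θ x) + θ x) ≠ 0 := by
    intro j hj h0
    apply hxne
    have h1 : (2 : ℤ) ^ j • (x + ε • c₀ • x) = 0 := by
      apply θ.injective
      rw [map_zsmul, map_add, map_zsmul, hθc, map_zero, add_comm]
      exact h0
    rw [show m - 3 = (m - 3 - j) + j by omega, pow_add, mul_smul, h1, smul_zero]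
  -- (e) `θ x = [κ, ρ]` for some `ρ ∈ Γ_{K(E[2^{M'}])}`
  obtain ⟨ρ, hρT, hρx⟩ : θ x ∈ H := hHbig _ hx'kill
  refine ⟨ρ, hρT, fun j hj ↦ ?_⟩
  rw [hρx]
  exact hx'ne j hj

/-- `[κ, (ρg)^τ (ρg)] = ε τ[κ, ρ] + [κ, ρ]` for an `ε`-eigenclass `κ`, `ρ, g ∈ Γ_{K(E[n])}` with
`[κ, g] = 0` (the value at the Frobenius `(τρg)²` of McCallum's proof of Cor. 3.2). [folklore] -/
theorem h1Eval_conjGalCMH_mul_mul_of_eigen {k : Type} {K : Type} [Field k] [Field K] [Algebra k K]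
    (V : WeierstrassCurve k) {σ : K ≃ₐ[k] K} {τ : AlgebraicClosure K ≃+* AlgebraicClosure K}
    (hτ : IsLiftOfAut σ τ) (hinv : ∀ x, τ (τ x) = x) (n : ℤ)
    {κ : galH1Torsion (V.baseChange K) n} {ε : ℤ} (hε : ε = 1 ∨ ε = -1)
    (hκ : conjAct V σ n κ = ε • κ) {ρ g : absoluteGaloisGroup K}
    (hρ : ρ ∈ torsionFixing (V.baseChange K) n) (hg : g ∈ torsionFixing (V.baseChange K) n)
    (hg0 : h1Eval (V.baseChange K) n κ g = 0) :
    h1Eval (V.baseChange K) n κ (hτ.conjGalCMH (ρ * g) * (ρ * g)) =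
      ε • hτ.torsionMap V n (h1Eval (V.baseChange K) n κ ρ) + h1Eval (V.baseChange K) n κ ρ := by
  have hρg : ρ * g ∈ torsionFixing (V.baseChange K) n := mul_mem hρ hg
  rw [h1Eval_mul _ _ κ (hτ.conjGalCMH_mem_torsionFixing V hinv _ hρg),
    hτ.h1Eval_conjGalCMH_of_eigen V hinv _ hε hκ hρg, h1Eval_mul _ _ κ hρ g, hg0, add_zero]

/-! ### The one-class theorem at `2`, one level up -/

/-- **Čebotarev at `2` for ONE eigenclass, ONE LEVEL UP (both signs of `Δ_E`, loss ≤ 2 bits,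
unconditional).** Let `E = W/ℚ` (globally minimal) have surjective `2`-adic tower, `K` imaginary
quadratic with `c ≠ 1` in `Aut(K/ℚ)` and `d_K·Δ_E ∉ ℚ^{×2}`, `κ ∈ H¹(K, E[2^M])` with
`c_* κ = ε κ` (`ε = ±1`) and `2^{m-1} κ ≠ 0`, and `M ≤ M'`. Then above every bound there is a
Kolyvagin prime `ℓ` at `2` with **`M' ≤ M(ℓ)`** (`Frob ℓ = Frob ∞` on `K(E[2^{M'}])`) at whose
place `λ` the classes `2^j κ`, `j + 3 ≤ m`, are not locally trivial (local order `≥ 2^{m-2}`).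
[cite: McCallumLMS1991, §3 Prop. 3.1, Cor. 3.2] [cite: Kolyvagin1991MathAnn, §2 (ref. [1] Prop. 8)]
[cite: WZhang2014, Notations (xii)] -/
theorem exists_kolyvaginPrime_gt_two_eigenclass_of_le {N : ℕ} [NeZero N] [W.IsElliptic]
    [W.IsGloballyMinimal] {K : Type} [Field K] [NumberField K] (hK : IsImaginaryQuadratic K)
    (hns : ¬ IsSquare ((NumberField.discr K : ℚ) * W.Δ))
    (hρ : ∀ n : ℕ, W.HasSurjectiveModNGaloisRep (2 ^ n : ℕ)) {c : K ≃ₐ[ℚ] K} (hc : c ≠ 1)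
    {M M' : ℕ} (hM : 1 ≤ M) (hMM' : M ≤ M') (κ : galH1Torsion (W.baseChange K) ((2 ^ M : ℕ) : ℤ))
    {ε : ℤ} (hε : ε = 1 ∨ ε = -1) (hκ : conjAct W c ((2 ^ M : ℕ) : ℤ) κ = ε • κ)
    {m : ℕ} (hm : (2 : ℤ) ^ (m - 1) • κ ≠ 0) (b : ℕ) :
    ∃ ℓ : ℕ, b < ℓ ∧ Zhang2014.IsKolyvaginPrime N W K 2 ℓ ∧ M' ≤ Zhang2014.kolyvaginIndex W 2 ℓ ∧
      FrobEqFrobInfty W K (2 ^ M') ℓ ∧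
      ∀ v : HeightOneSpectrum (𝓞 K), (ℓ : 𝓞 K) ∈ v.asIdeal → ∀ j : ℕ, j + 3 ≤ m →
        ((2 ^ j : ℕ) : ℤ) • κ ∉
          (W.baseChange K).torsionLocalKer (v.adicCompletion K) ((2 ^ M : ℕ) : ℤ) := by
  classical
  have hp : Nat.Prime 2 := Nat.prime_two
  haveI : Fact (Nat.Prime 2) := ⟨hp⟩
  have hM' : 1 ≤ M' := hM.trans hMM'
  have hdvdMM' : ((2 ^ M : ℕ) : ℤ) ∣ ((2 ^ M' : ℕ) : ℤ) := by exact_mod_cast Nat.pow_dvd_pow 2 hMM'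
  have hle := torsionFixing_le_of_dvd (W.baseChange K) hdvdMM'
  -- complex conjugation and its involutive lift to `K̄`
  obtain ⟨c₀, hc₀⟩ := exists_isComplexConjugation (Rat.castHom ℝ)
  have ht : IsLiftOfAut c (absGaloisTransport (K := ℚ) (L := K) c₀).toRingEquiv :=
    RatClosure.isLiftOfAut_absGaloisTransport_of_isImaginaryQuadratic hK hc hc₀
  have hinv : ∀ x, (absGaloisTransport (K := ℚ) (L := K) c₀).toRingEquiv
      ((absGaloisTransport (K := ℚ) (L := K) c₀).toRingEquiv x) = x := fun x ↦
    RatClosure.absGaloisTransport_absGaloisTransport_of_sq_eq_one hc₀.sq_eq_one x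
  -- ### Step B′
  obtain ⟨ρ, hρT, hρv⟩ :=
    exists_mem_torsionFixing_eigenvalue_large hK hns hρ hc₀ ht hM hMM' κ hε hm
  -- ### Steps C–G (two levels), above a bound that also clears the bad primes of `E`
  obtain ⟨B₀, hB₀⟩ := exists_gt_hasGoodReductionAt W
  obtain ⟨ℓ, hbℓ, hℓ, hℓN, hℓD, hℓ2, hprime, h32, g, hg, hgT', hloc⟩ :=
    exists_kolyvaginPrime_gt_of_galoisElement_of_le (W := W) (N := N)
      Automorphic.chebotarev_artinRep_of_galoisSide hK hp hMM' hc₀ ht hinv (fun _ : Fin 1 ↦ κ)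
      hρT (max b B₀)
  have hbℓ' : b < ℓ := lt_of_le_of_lt (le_max_left _ _) hbℓ
  have hidx : M' ≤ Zhang2014.kolyvaginIndex W 2 ℓ :=
    le_kolyvaginIndex_of_frobEqFrobInfty hM' hℓ hℓ2 h32
      (hB₀ ℓ hℓ (lt_of_le_of_lt (le_max_right _ _) hbℓ))
  have hkoly : Zhang2014.IsKolyvaginPrime N W K 2 ℓ :=
    ⟨hℓ, hℓN, hℓD, hℓ2, hprime, lt_of_lt_of_le (by omega) hidx⟩
  refine ⟨ℓ, hbℓ', hkoly, hidx, h32, fun v hv j hj hmem ↦ ?_⟩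
  have hκcl : κ ∈ AddSubgroup.closure (Set.range fun _ : Fin 1 ↦ κ) :=
    AddSubgroup.subset_closure (Set.mem_range.mpr ⟨0, rfl⟩)
  have hcl : ((2 ^ j : ℕ) : ℤ) • κ ∈ AddSubgroup.closure (Set.range fun _ : Fin 1 ↦ κ) :=
    AddSubgroup.zsmul_mem _ hκcl _
  have hρg : ρ * g ∈ torsionFixing (W.baseChange K) ((2 ^ M' : ℕ) : ℤ) := mul_mem hρT hgT'
  have hF : ht.conjGalCMH (ρ * g) * (ρ * g) ∈ torsionFixing (W.baseChange K) ((2 ^ M : ℕ) : ℤ) :=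
    mul_mem (ht.conjGalCMH_mem_torsionFixing W hinv _ (hle hρg)) (hle hρg)
  have h0 := (hloc _ hcl v hv).mp hmem
  rw [h1Eval_zsmul _ _ _ _ hF,
    h1Eval_conjGalCMH_mul_mul_of_eigen W ht hinv _ hε hκ (hle hρT) (hle hgT') (hg.2 0)] at h0
  exact hρv j hj (by exact_mod_cast h0)

/-- **The `Set.Infinite` form, one level up.** [cite: McCallumLMS1991, §3 Cor. 3.2]
[cite: WZhang2014, Notations (xii)] -/
theorem setInfinite_kolyvaginPrime_two_eigenclass_of_le {N : ℕ} [NeZero N] [W.IsElliptic]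
    [W.IsGloballyMinimal] {K : Type} [Field K] [NumberField K] (hK : IsImaginaryQuadratic K)
    (hns : ¬ IsSquare ((NumberField.discr K : ℚ) * W.Δ))
    (hρ : ∀ n : ℕ, W.HasSurjectiveModNGaloisRep (2 ^ n : ℕ)) {c : K ≃ₐ[ℚ] K} (hc : c ≠ 1)
    {M M' : ℕ} (hM : 1 ≤ M) (hMM' : M ≤ M') (κ : galH1Torsion (W.baseChange K) ((2 ^ M : ℕ) : ℤ))
    {ε : ℤ} (hε : ε = 1 ∨ ε = -1) (hκ : conjAct W c ((2 ^ M : ℕ) : ℤ) κ = ε • κ)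
    {m : ℕ} (hm : (2 : ℤ) ^ (m - 1) • κ ≠ 0) :
    Set.Infinite {ℓ : ℕ | Zhang2014.IsKolyvaginPrime N W K 2 ℓ ∧
      M' ≤ Zhang2014.kolyvaginIndex W 2 ℓ ∧ FrobEqFrobInfty W K (2 ^ M') ℓ ∧
      ∀ v : HeightOneSpectrum (𝓞 K), (ℓ : 𝓞 K) ∈ v.asIdeal → ∀ j : ℕ, j + 3 ≤ m →
        ((2 ^ j : ℕ) : ℤ) • κ ∉
          (W.baseChange K).torsionLocalKer (v.adicCompletion K) ((2 ^ M : ℕ) : ℤ)} := by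
  refine Set.infinite_of_forall_exists_gt fun b ↦ ?_
  obtain ⟨ℓ, hbℓ, hkoly, hidx, h32, hloc⟩ :=
    exists_kolyvaginPrime_gt_two_eigenclass_of_le (N := N) hK hns hρ hc hM hMM' κ hε hκ hm b
  exact ⟨ℓ, ⟨hkoly, hidx, h32, hloc⟩, hbℓ⟩

/-- The unique place of `K` above an inert Kolyvagin prime, as a `HeightOneSpectrum`. [folklore] -/
theorem exists_natCast_mem_of_isKolyvaginPrime {N : ℕ} [W.IsGloballyMinimal] {K : Type} [Field K]
    [NumberField K] {q : ℕ} (hq : Zhang2014.IsKolyvaginPrime N W K 2 q) :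
    ∃ v : HeightOneSpectrum (𝓞 K), ((q : ℕ) : 𝓞 K) ∈ v.asIdeal := by
  have hne : Ideal.span {((q : ℕ) : 𝓞 K)} ≠ ⊥ := by
    rw [Ne, Ideal.span_singleton_eq_bot]; exact_mod_cast hq.1.ne_zero
  exact ⟨⟨Ideal.span {((q : ℕ) : 𝓞 K)}, hq.2.2.2.2.1, hne⟩, Ideal.mem_span_singleton_self _⟩

/-- **T5b(a′)-shaped form: a NEW window prime outside a finite set, with the margin
`M + 1 ≤ M(q)`.** Under the hypotheses of `exists_kolyvaginPrime_gt_two_eigenclass_of_le`, with the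
order of `κ` given as in the lead's window step (`2^{e'} κ ≠ 0` whenever `e' + e < M`), for every
finite set `S` there is a Kolyvagin prime `q ∉ S` at `2` with `M + 1 ≤ M(q)` and a place `v ∋ q` of
`K` at which `2^{e'} κ` is NOT locally trivial whenever `e' + e + 2 < M` (defect `D = 2`).
[cite: Kolyvagin1991MathAnn, §2 (proof of Thm. 2.2; ref. [1] Prop. 8)]
[cite: McCallumLMS1991, §3 Cor. 3.2] -/
theorem exists_kolyvaginPrime_notMem_two_eigenclass {N : ℕ} [NeZero N] [W.IsElliptic]
    [W.IsGloballyMinimal] {K : Type} [Field K] [NumberField K] (hK : IsImaginaryQuadratic K)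
    (hns : ¬ IsSquare ((NumberField.discr K : ℚ) * W.Δ))
    (hρ : ∀ n : ℕ, W.HasSurjectiveModNGaloisRep (2 ^ n : ℕ)) {c : K ≃ₐ[ℚ] K} (hc : c ≠ 1)
    {M : ℕ} (hM : 1 ≤ M) (κ : galH1Torsion (W.baseChange K) ((2 ^ M : ℕ) : ℤ))
    {ε : ℤ} (hε : ε = 1 ∨ ε = -1) (hκ : conjAct W c ((2 ^ M : ℕ) : ℤ) κ = ε • κ)
    {e : ℕ} (hord : ∀ e' : ℕ, e' + e < M → ((2 ^ e' : ℕ) : ℤ) • κ ≠ 0) (S : Finset ℕ) :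
    ∃ q : ℕ, q ∉ S ∧ Zhang2014.IsKolyvaginPrime N W K 2 q ∧
      M + 1 ≤ Zhang2014.kolyvaginIndex W 2 q ∧
      ∃ v : HeightOneSpectrum (𝓞 K), ((q : ℕ) : 𝓞 K) ∈ v.asIdeal ∧
        ∀ e' : ℕ, e' + e + 2 < M →
          ((2 ^ e' : ℕ) : ℤ) • κ ∉
            (W.baseChange K).torsionLocalKer (v.adicCompletion K) ((2 ^ M : ℕ) : ℤ) := by
  classical
  by_cases hMe : M ≤ e
  · -- the local clause is vacuous: any Kolyvagin prime of index `≥ M + 1` outside `S`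
    obtain ⟨q, hbq, hkoly, hidx, -⟩ := exists_kolyvaginPrime_gt_le_kolyvaginIndex (W := W)
      (N := N) hK hc (M' := M + 1) (by omega) (S.sup id)
    have hqS : q ∉ S := fun h ↦ by
      have := Finset.le_sup (f := id) h
      simp only [id_eq] at this
      omega
    obtain ⟨v, hv⟩ := exists_natCast_mem_of_isKolyvaginPrime (W := W) hkoly
    exact ⟨q, hqS, hkoly, hidx, v, hv, fun e' he' ↦ absurd he' (by omega)⟩
  · push Not at hMe
    have hm : (2 : ℤ) ^ (M - e - 1) • κ ≠ 0 := by
      intro h0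
      apply hord (M - e - 1) (by omega)
      exact_mod_cast h0
    have hinf := setInfinite_kolyvaginPrime_two_eigenclass_of_le (N := N) hK hns hρ hc hM
      (Nat.le_succ M) κ hε hκ hm
    obtain ⟨q, hq⟩ := (hinf.sdiff S.finite_toSet).nonempty
    obtain ⟨⟨hkoly, hidx, -, hloc⟩, hqS⟩ := hq
    obtain ⟨v, hv⟩ := exists_natCast_mem_of_isKolyvaginPrime (W := W) hkoly
    exact ⟨q, hqS, hkoly, hidx, v, hv, fun e' he' ↦ hloc v hv e' (by omega)⟩

end Shifted

end Summit.BirchSwinnertonDyer.BirchSwinnertonDyer.Theorems.KolyvaginLowerBoundAtTwo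

end
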